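/-
Copyright (c) 2026 the pub-hodgecm-mathlib formalisation cell (harness21).  Prover seat hodgecm-mathlib-F0P2-p08 (g3), Track B «K2-LIT»,
#184♮ = hLiu418 = `stmt-HodgeConjecture-24832`; socket #41 `sig_K2LiuSiegelEisensteinContinuation`, KIND W, brick (iii-fin-read): the finite local letters `hFfinI`, `hFfin`
of ★ ED. 4 ∕ ★ `kindW_block_cm_of_localLetters` for the reading `Ffin := kindWFfin …` (★ p863154) over the (KW-fac) reading of the local factors.
THEOREMS ONLY (no `def`, no `instance`, no notation, no named-fact hypothesis, no `sorry`).
-/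
import Summits.HodgeConjecture.HodgeConjecture.Theorems.K2LiuKindWFactorLetters       -- ★ (x-a-int-fac) `hsec_of_reading`, `hsm_of_reading` (⊇ ★ (iii-fin-int) `hint_of_isLocalSiegelSection`)
import Summits.HodgeConjecture.HodgeConjecture.Theorems.K2LiuKindWFiniteLetterDefs    -- ★ p863154 (iii-fin) `kindWFfin`, (T1) `kindWFfin_eq_integral`, (T3) `differentiableOn_kindWFfin_of_stable`, `kindWFfin_of_not_mem`
import HarnessLib

/-!
# Crux `HLiu418`, socket #41, KIND W — brick (iii-fin-read) `K2LiuKindWFiniteLetterOfReading`: THE FINITE LOCAL LETTERS OF ★ ED. 4 FOR `Ffin := kindWFfin`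
# `hFfinI` (★, no by-value letter beyond the (KW-fac) reading) and `hFfin` (modulo the per-place Φ5 stability ∕ differentiability letters)

Cell `hodgecm-mathlib`, crux item hLiu418 = `stmt-HodgeConjecture-24832` (helper lane `--supports … --as helper`, count-neutral), route of record
`HCCMUnconditional`; squad K2 ∕ K2Liu, road `K2_Liu`, socket #41, KIND W; KW desk of record F0P2-p08 (g3).  ★ (ii)′ ∕ ★ `kindW_block_cm_of_localLetters` (K2E4-p10 (g10)) take the
continued FINITE local letters `Ffin` BY VALUE with `hFfinI` (= the local Whittaker integral on `{n∕2 < re s}`, `det S ≠ 0`, at `v ∈ kindWFinset T₀ ↑S h`) and `hFfin` (holomorphy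
on `{0 < re s}` at every `v`).  ★ p863154 (K2E3-p29) DEFINES the letter of record `kindWFfin T₀ νv π FvT j S h v s` (limit of the Φ5 ball integrals; `0` off `kindWFinset`) and proves
(T1) `kindWFfin_eq_integral` under a uniformiser letter `hπ` and the per-place integrability `hint`, (T3) `differentiableOn_kindWFfin_of_stable` under the Φ5 letters `hstable`,
`hdiff`.  THIS FILE reads `Ffin j S h v s := kindWFfin T₀ νv ϖ FvT j S h v s` at the chosen uniformisers `ϖ_v := HeckeCharacter.uniformizer L⁺ v` (hypothesis `hreadF`, pointwise;
the tie passes `fun … => rfl`) over the (KW-fac) reading of `FvT` (★ p863379 §3; letters `hχS₀`, `hb`, `hread` as in ★ p863446) and pays: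
* §1 **`hFfinI_of_reading`** — ★ ED. 4's `hFfinI` VERBATIM (`n := 2`), NO further letter: (T1) with `hπ :=` ★ `HeckeCharacter.valued_uniformizer` and `hint :=` ★ (iii-fin-int)
  `hint_of_isLocalSiegelSection` ∘ ★ (x-a-int-fac) `hsec_of_reading` ∕ `hsm_of_reading` (`χ` unitary).
* §2 **`hFfin_of_reading`** — ★ ED. 4's `hFfin` VERBATIM from the per-place Φ5 letters `hsd : ∀ j S h (v ∈ kindWFinset), ∃ K, hstable ∧ hdiff` ((iii-fin-Φ5), K2E3-p29): (T3) on
  `kindWFinset`, ★ `kindWFfin_of_not_mem` (the constant `0`) off it.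
[KudlaRallis1994, §2] [Shimura1997, §18.3–18.4] [Casselman1980, §3] [Tan1999, §3].
HONEST LABEL.  Count-neutral helper; closes no socket by itself: `HC_CM` is proved only modulo the 7 printed citations (2 remaining named inputs:
hLiu418 = `stmt-HodgeConjecture-24832`, h413 = `stmt-HodgeConjecture-24833`) until rung 0 closes.  NOT HERE (by value): the Φ5 letters `hstable`, `hdiff` for the concrete factors.

## References
* [KudlaRallis1994] S. Kudla, S. Rallis, Ann. of Math. 140 (1994): §2.   * [Shimura1997] G. Shimura, CBMS 93 (1997): §18.3–18.4.
* [Casselman1980] W. Casselman, Compositio Math. 40 (1980): §3.   * [Tan1999] V. Tan, Canad. J. Math. 51 (1999): §3.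
-/

set_option autoImplicit false
-- the mandated namespace repeats the single-problem summit's segment (`HodgeConjecture.HodgeConjecture`)
set_option linter.dupNamespace false

noncomputable section

open scoped Matrix ComplexConjugate NNReal ENNReal BigOperators
open NumberField IsDedekindDomain Matrix MeasureTheory Measure Set Filter
open Literature.NumberTheory.Automorphic hiding IsKFinite
open Literature.NumberTheory.Automorphic.UnitaryGroup Literature.NumberTheory.GaloisRepresentations
open Literature.NumberTheory.LFunctions
open Literature.NumberTheory.GelbartRogawski1991 Literature.NumberTheory.GelbartRogawski1991.GRConstruction
open Literature.NumberTheory.GelbartRogawski1991.UnitaryDualPair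
open Literature.NumberTheory.K2Lit Literature.NumberTheory.K2Lit.SiegelDoubled Literature.NumberTheory.K2Lit.LocalSiegelDoubled Literature.NumberTheory.K2Lit.PlaceSplitting
open Summit.HodgeConjecture.HodgeConjecture.Cruxes.HLiu418.K2LiuSiegelUnipotentFourierDefs
open Summit.HodgeConjecture.HodgeConjecture.Cruxes.HLiu418.K2LiuSiegelUnipotentLocalDefs
open Summit.HodgeConjecture.HodgeConjecture.Cruxes.HLiu418.K2LiuSiegelUnipotentSplitDefs
open Summit.HodgeConjecture.HodgeConjecture.Cruxes.HLiu418.K2LiuSiegelEisensteinKindWLetters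
open Summit.HodgeConjecture.HodgeConjecture.Cruxes.HLiu418.K2LiuKindWFiniteLetterIntegrable (hint_of_isLocalSiegelSection)
open Summit.HodgeConjecture.HodgeConjecture.Cruxes.HLiu418.K2LiuKindWFactorLetters (hsec_of_reading hsm_of_reading)
open Summit.HodgeConjecture.HodgeConjecture.Cruxes.HLiu418.K2LiuKindWFiniteLetterDefs (kindWFfin kindWLocalBall kindWFfin_eq_integral differentiableOn_kindWFfin_of_stable kindWFfin_of_not_mem)

namespace Summit.HodgeConjecture.HodgeConjecture.Cruxes.HLiu418.K2LiuKindWFiniteLetterOfReading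

variable (L : Type) [Field L] [NumberField L] [IsCMField L]
variable {N M : ℕ} (e : Fin N × Fin M ≃ Fin 2)
  (dV : Fin N → L) (hdV : ∀ i, IsCMField.complexConj L (dV i) = dV i)
  (dW : Fin M → L) (hdW : ∀ i, IsCMField.complexConj L (dW i) = dW i)
  (hdV0 : ∀ i, dV i ≠ 0) (hdW0 : ∀ i, dW i ≠ 0)
  [DecidableEq (HeightOneSpectrum (𝓞 (Fp L)))]
  [∀ v : HeightOneSpectrum (𝓞 (Fp L)), MeasurableSpace ↥(unipDeltaLoc L e dV hdV dW hdW v)]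
  [∀ v : HeightOneSpectrum (𝓞 (Fp L)), BorelSpace ↥(unipDeltaLoc L e dV hdV dW hdW v)]
  (T₀ : Finset (HeightOneSpectrum (𝓞 (Fp L))))
  (νv : ∀ v : HeightOneSpectrum (𝓞 (Fp L)), Measure ↥(unipDeltaLoc L e dV hdV dW hdW v)) [∀ v, (νv v).IsHaarMeasure]
  {χ : HeckeCharacter L} (hχu : χ.IsUnitary) (𝒦 : IwasawaDatum L e dV hdV dW hdW) (s₀ : ℂ)
  {S₀ : Finset (HeightOneSpectrum (𝓞 (Fp L)))} (hχS₀ : ∀ v, v ∉ S₀ → ∀ w : UnitaryGroup.PlacesOver L v, χ.IsUnramifiedAt w.1)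
  {m : ℕ} (b : Fin m → (v : HeightOneSpectrum (𝓞 (Fp L))) → (UnitaryGroup.localPi L (IsCMField.complexConj L) (2 + 2) (hermD L e dV hdV dW hdW) v → ℂ))
  (hb : ∀ i, ∀ v ∈ S₀, ∀ s : ℂ, (fun u => ((modDelta L e dV hdV dW hdW (𝒦.pPart (locToAdelic L e dV hdV dW hdW v u)) : ℝ) : ℂ) ^ (2 * (s - s₀)) * b i v u) ∈
    localDegPS (Fp L) L (IsCMField.complexConj L) (complexConj_imagUnit L) (imagUnit_ne_zero L) (imagUnit_mul_self L)
      v 2 (gramR_isSymm L e dV hdV dW hdW) (hermD_eq_map_gramD L e dV hdV dW hdW) (fun w => χ.localComponent w.1) s)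
  (FvT : Fin m → ∀ (S : skewMatrices ((IsCMField.complexConj L : L ≃ₐ[Fp L] L) : L →+* L) ((gramR L e dV hdV dW hdW).map (algebraMap (Fp L) L)))
    (h : HA L e dV hdV dW hdW) (v : (kindWFinset L e dV hdV dW hdW T₀ (S : Matrix (Fin 2) (Fin 2) L) h)),
    ℂ → UnitaryGroup.localPi L (IsCMField.complexConj L) (2 + 2) (hermD L e dV hdV dW hdW) v.1 → ℂ)
  (hread : ∀ (j : Fin m) (S : skewMatrices ((IsCMField.complexConj L : L ≃ₐ[Fp L] L) : L →+* L) ((gramR L e dV hdV dW hdW).map (algebraMap (Fp L) L)))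
    (h : HA L e dV hdV dW hdW) (v : (kindWFinset L e dV hdV dW hdW T₀ (S : Matrix (Fin 2) (Fin 2) L) h)) (s : ℂ)
    (y : UnitaryGroup.localPi L (IsCMField.complexConj L) (2 + 2) (hermD L e dV hdV dW hdW) v.1),
    FvT j S h v s y = if v.1 ∈ S₀ then ((modDelta L e dV hdV dW hdW (𝒦.pPart (locToAdelic L e dV hdV dW hdW v.1 y)) : ℝ) : ℂ) ^ (2 * (s - s₀)) * b j v.1 y
      else LambdaLoc L e dV hdV dW hdW v.1 χ s y)
  (Ffin : Fin m → skewMatrices ((IsCMField.complexConj L : L ≃ₐ[Fp L] L) : L →+* L) ((gramR L e dV hdV dW hdW).map (algebraMap (Fp L) L)) → HA L e dV hdV dW hdW →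
    HeightOneSpectrum (𝓞 (Fp L)) → ℂ → ℂ)
  (hreadF : ∀ (j : Fin m) (S : skewMatrices ((IsCMField.complexConj L : L ≃ₐ[Fp L] L) : L →+* L) ((gramR L e dV hdV dW hdW).map (algebraMap (Fp L) L)))
    (h : HA L e dV hdV dW hdW) (v : HeightOneSpectrum (𝓞 (Fp L))) (s : ℂ),
    Ffin j S h v s = kindWFfin L e dV hdV dW hdW T₀ νv (fun v => (HeckeCharacter.uniformizer (Fp L) v : v.adicCompletion (Fp L))) FvT j S h v s)

/-! ## §1 `hFfinI`: the letter of record IS the local Whittaker integral on the half-plane of convergence -/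

include hdV0 hdW0 hχu hχS₀ hb hread hreadF in
set_option maxHeartbeats 800000 in -- MEASURED: 400 000 ✗ (`whnf` of the statement — ★ ED. 4's dependent `FvT` ∕ `hFfinI` block over the reading letters) ∕ 800 000 ✓; scoped 4×, plain `rw`∕`exact`
/-- **`hFfinI` OF ★ ED. 4 FOR `Ffin := kindWFfin` OVER THE (KW-fac) READING, NO FURTHER LETTER**: ★ (T1) `kindWFfin_eq_integral` at the chosen uniformisers (★
`HeckeCharacter.valued_uniformizer`) with the per-place integrability paid by ★ (iii-fin-int) ∘ ★ (x-a-int-fac) (smooth local Siegel factors, `χ` unitary).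
[cite: KudlaRallis1994, §2] [cite: Shimura1997, §18.3] [cite: Casselman1980, §3] -/
theorem hFfinI_of_reading :
    ∀ (j : Fin m) (S : skewMatrices ((IsCMField.complexConj L : L ≃ₐ[Fp L] L) : L →+* L) ((gramR L e dV hdV dW hdW).map (algebraMap (Fp L) L))) (h : HA L e dV hdV dW hdW) (v : (kindWFinset L e dV hdV dW hdW T₀ (S : Matrix (Fin 2) (Fin 2) L) h)) (s : ℂ), ((2 : ℕ) : ℝ) / 2 < s.re → (S : Matrix (Fin 2) (Fin 2) L).det ≠ 0 →
      Ffin j S h v.1 s = ∫ y, conj (unipDeltaChar L e dV hdV dW hdW (S : Matrix (Fin 2) (Fin 2) L)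
            (locToAdelic L e dV hdV dW hdW v.1
              ((y : ↥(unipDeltaLoc L e dV hdV dW hdW v.1)) : UnitaryGroup.localPi L (IsCMField.complexConj L) (2 + 2) (hermD L e dV hdV dW hdW) v.1)) : ℂ) *
          FvT j S h v s (UnitaryGroup.evalPlace (Fp L) L (IsCMField.complexConj L) (2 + 2) (hermD L e dV hdV dW hdW) v.1
                (UnitaryGroup.finPart (Fp L) L (IsCMField.complexConj L) (2 + 2) (hermD L e dV hdV dW hdW) (SiegelDoubled.weylDelta L e dV hdV dW hdW)) *
              ((y : ↥(unipDeltaLoc L e dV hdV dW hdW v.1)) : UnitaryGroup.localPi L (IsCMField.complexConj L) (2 + 2) (hermD L e dV hdV dW hdW) v.1) *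
              UnitaryGroup.evalPlace (Fp L) L (IsCMField.complexConj L) (2 + 2) (hermD L e dV hdV dW hdW) v.1
                (UnitaryGroup.finPart (Fp L) L (IsCMField.complexConj L) (2 + 2) (hermD L e dV hdV dW hdW) h)) ∂(νv v.1) := by
  intro j S h v s hs hdet
  rw [hreadF]
  exact kindWFfin_eq_integral L e dV hdV dW hdW T₀ νv (fun v => HeckeCharacter.valued_uniformizer (K := Fp L) v) FvT
    (hint_of_isLocalSiegelSection L e dV hdV dW hdW hdV0 hdW0 T₀ νv hχu FvT
      (hsec_of_reading L e dV hdV dW hdW 𝒦 s₀ hχS₀ b hb FvT hread) (hsm_of_reading L e dV hdV dW hdW 𝒦 s₀ hχS₀ b hb FvT hread)) j S h v s hs hdet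

/-! ## §2 `hFfin`: holomorphy from the per-place Φ5 letters -/

omit [∀ v : HeightOneSpectrum (𝓞 (Fp L)), BorelSpace ↥(unipDeltaLoc L e dV hdV dW hdW v)] [∀ v, (νv v).IsHaarMeasure] in
include hreadF in
set_option maxHeartbeats 800000 in -- MEASURED: 400 000 ✗ (`whnf` of the Φ5 `hstable` ∕ `hdiff` blocks of ★ (T3)) ∕ 800 000 ✓; scoped 4×, no search tactics
/-- **`hFfin` OF ★ ED. 4 FOR `Ffin := kindWFfin`, FROM THE PER-PLACE Φ5 LETTERS**: at `v ∈ kindWFinset T₀ ↑S h` ★ (T3) `differentiableOn_kindWFfin_of_stable` under the stability ∕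
differentiability letters `hsd` ((iii-fin-Φ5), by value); off it the letter of record is the constant `0` (★ `kindWFfin_of_not_mem`). [cite: KudlaRallis1994, §2] [cite: Shimura1997, §18.3–18.4] -/
theorem hFfin_of_reading
    (hsd : ∀ (j : Fin m) (S : skewMatrices ((IsCMField.complexConj L : L ≃ₐ[Fp L] L) : L →+* L) ((gramR L e dV hdV dW hdW).map (algebraMap (Fp L) L)))
      (h : HA L e dV hdV dW hdW) (v : (kindWFinset L e dV hdV dW hdW T₀ (S : Matrix (Fin 2) (Fin 2) L) h)), ∃ K : ℕ,
      (∀ (s : ℂ) (k : ℕ), K ≤ k →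
      ∫ y in kindWLocalBall L e dV hdV dW hdW v.1 ((fun v => (HeckeCharacter.uniformizer (Fp L) v : v.adicCompletion (Fp L))) v.1) (-(k : ℤ)),
        conj (unipDeltaChar L e dV hdV dW hdW (S : Matrix (Fin 2) (Fin 2) L)
            (locToAdelic L e dV hdV dW hdW v.1
              ((y : ↥(unipDeltaLoc L e dV hdV dW hdW v.1)) : UnitaryGroup.localPi L (IsCMField.complexConj L) (2 + 2) (hermD L e dV hdV dW hdW) v.1)) : ℂ) *
          FvT j S h v s (UnitaryGroup.evalPlace (Fp L) L (IsCMField.complexConj L) (2 + 2) (hermD L e dV hdV dW hdW) v.1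
                (UnitaryGroup.finPart (Fp L) L (IsCMField.complexConj L) (2 + 2) (hermD L e dV hdV dW hdW) (SiegelDoubled.weylDelta L e dV hdV dW hdW)) *
              ((y : ↥(unipDeltaLoc L e dV hdV dW hdW v.1)) : UnitaryGroup.localPi L (IsCMField.complexConj L) (2 + 2) (hermD L e dV hdV dW hdW) v.1) *
              UnitaryGroup.evalPlace (Fp L) L (IsCMField.complexConj L) (2 + 2) (hermD L e dV hdV dW hdW) v.1
                (UnitaryGroup.finPart (Fp L) L (IsCMField.complexConj L) (2 + 2) (hermD L e dV hdV dW hdW) h)) ∂(νv v.1) =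
      ∫ y in kindWLocalBall L e dV hdV dW hdW v.1 ((fun v => (HeckeCharacter.uniformizer (Fp L) v : v.adicCompletion (Fp L))) v.1) (-(K : ℤ)),
        conj (unipDeltaChar L e dV hdV dW hdW (S : Matrix (Fin 2) (Fin 2) L)
            (locToAdelic L e dV hdV dW hdW v.1
              ((y : ↥(unipDeltaLoc L e dV hdV dW hdW v.1)) : UnitaryGroup.localPi L (IsCMField.complexConj L) (2 + 2) (hermD L e dV hdV dW hdW) v.1)) : ℂ) *
          FvT j S h v s (UnitaryGroup.evalPlace (Fp L) L (IsCMField.complexConj L) (2 + 2) (hermD L e dV hdV dW hdW) v.1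
                (UnitaryGroup.finPart (Fp L) L (IsCMField.complexConj L) (2 + 2) (hermD L e dV hdV dW hdW) (SiegelDoubled.weylDelta L e dV hdV dW hdW)) *
              ((y : ↥(unipDeltaLoc L e dV hdV dW hdW v.1)) : UnitaryGroup.localPi L (IsCMField.complexConj L) (2 + 2) (hermD L e dV hdV dW hdW) v.1) *
              UnitaryGroup.evalPlace (Fp L) L (IsCMField.complexConj L) (2 + 2) (hermD L e dV hdV dW hdW) v.1
                (UnitaryGroup.finPart (Fp L) L (IsCMField.complexConj L) (2 + 2) (hermD L e dV hdV dW hdW) h)) ∂(νv v.1)) ∧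
      (Differentiable ℂ fun s : ℂ =>
      ∫ y in kindWLocalBall L e dV hdV dW hdW v.1 ((fun v => (HeckeCharacter.uniformizer (Fp L) v : v.adicCompletion (Fp L))) v.1) (-(K : ℤ)),
        conj (unipDeltaChar L e dV hdV dW hdW (S : Matrix (Fin 2) (Fin 2) L)
            (locToAdelic L e dV hdV dW hdW v.1
              ((y : ↥(unipDeltaLoc L e dV hdV dW hdW v.1)) : UnitaryGroup.localPi L (IsCMField.complexConj L) (2 + 2) (hermD L e dV hdV dW hdW) v.1)) : ℂ) *
          FvT j S h v s (UnitaryGroup.evalPlace (Fp L) L (IsCMField.complexConj L) (2 + 2) (hermD L e dV hdV dW hdW) v.1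
                (UnitaryGroup.finPart (Fp L) L (IsCMField.complexConj L) (2 + 2) (hermD L e dV hdV dW hdW) (SiegelDoubled.weylDelta L e dV hdV dW hdW)) *
              ((y : ↥(unipDeltaLoc L e dV hdV dW hdW v.1)) : UnitaryGroup.localPi L (IsCMField.complexConj L) (2 + 2) (hermD L e dV hdV dW hdW) v.1) *
              UnitaryGroup.evalPlace (Fp L) L (IsCMField.complexConj L) (2 + 2) (hermD L e dV hdV dW hdW) v.1
                (UnitaryGroup.finPart (Fp L) L (IsCMField.complexConj L) (2 + 2) (hermD L e dV hdV dW hdW) h)) ∂(νv v.1))) :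
    ∀ j S (h : HA L e dV hdV dW hdW) v, DifferentiableOn ℂ (Ffin j S h v) {s : ℂ | 0 < s.re} := by
  intro j S h v
  have hfun : Ffin j S h v = kindWFfin L e dV hdV dW hdW T₀ νv (fun v => (HeckeCharacter.uniformizer (Fp L) v : v.adicCompletion (Fp L))) FvT j S h v :=
    funext fun s => hreadF j S h v s
  rw [hfun]
  by_cases hv : v ∈ kindWFinset L e dV hdV dW hdW T₀ (S : Matrix (Fin 2) (Fin 2) L) h
  · obtain ⟨K, hstable, hdiff⟩ := hsd j S h ⟨v, hv⟩
    exact differentiableOn_kindWFfin_of_stable L e dV hdV dW hdW T₀ νv _ FvT j S h ⟨v, hv⟩ K hstable hdiff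
  · have h0 : kindWFfin L e dV hdV dW hdW T₀ νv (fun v => (HeckeCharacter.uniformizer (Fp L) v : v.adicCompletion (Fp L))) FvT j S h v = fun _ => 0 :=
      funext fun s => kindWFfin_of_not_mem L e dV hdV dW hdW T₀ νv _ FvT j S h hv s
    rw [h0]
    exact differentiableOn_const 0

/-! ## §3 (ED. 2) The same letters for the reading `Ffin := if det S = 0 then 0 else kindWFfin …` (KW letters are read only at non-singular indices) -/

section AtZero

open scoped Classical

variable (Ffin' : Fin m → skewMatrices ((IsCMField.complexConj L : L ≃ₐ[Fp L] L) : L →+* L) ((gramR L e dV hdV dW hdW).map (algebraMap (Fp L) L)) → HA L e dV hdV dW hdW →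
    HeightOneSpectrum (𝓞 (Fp L)) → ℂ → ℂ)
  (hreadF' : ∀ (j : Fin m) (S : skewMatrices ((IsCMField.complexConj L : L ≃ₐ[Fp L] L) : L →+* L) ((gramR L e dV hdV dW hdW).map (algebraMap (Fp L) L)))
    (h : HA L e dV hdV dW hdW) (v : HeightOneSpectrum (𝓞 (Fp L))) (s : ℂ),
    Ffin' j S h v s = if (S : Matrix (Fin 2) (Fin 2) L).det = 0 then 0 else
      kindWFfin L e dV hdV dW hdW T₀ νv (fun v => (HeckeCharacter.uniformizer (Fp L) v : v.adicCompletion (Fp L))) FvT j S h v s)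

include hdV0 hdW0 hχu hχS₀ hb hread hreadF' in
set_option maxHeartbeats 800000 in -- MEASURED as §1 (same statement telescope; 400 000 ✗ ∕ 800 000 ✓)
/-- **`hFfinI` OF ★ ED. 4 FOR `Ffin := if det ↑S = 0 then 0 else kindWFfin …`** (ED. 2; K2E3-p37 (g3)'s flag (F-det): far-shell stability fails at singular `S`, so the letter of
record is read as `0` there — `hFfinI` only asks `det ↑S ≠ 0`, where the reading is §1's). [cite: KudlaRallis1994, §2] [cite: Shimura1997, §18.3] -/
theorem hFfinI_of_reading' :
    ∀ (j : Fin m) (S : skewMatrices ((IsCMField.complexConj L : L ≃ₐ[Fp L] L) : L →+* L) ((gramR L e dV hdV dW hdW).map (algebraMap (Fp L) L))) (h : HA L e dV hdV dW hdW) (v : (kindWFinset L e dV hdV dW hdW T₀ (S : Matrix (Fin 2) (Fin 2) L) h)) (s : ℂ), ((2 : ℕ) : ℝ) / 2 < s.re → (S : Matrix (Fin 2) (Fin 2) L).det ≠ 0 →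
      Ffin' j S h v.1 s = ∫ y, conj (unipDeltaChar L e dV hdV dW hdW (S : Matrix (Fin 2) (Fin 2) L)
            (locToAdelic L e dV hdV dW hdW v.1
              ((y : ↥(unipDeltaLoc L e dV hdV dW hdW v.1)) : UnitaryGroup.localPi L (IsCMField.complexConj L) (2 + 2) (hermD L e dV hdV dW hdW) v.1)) : ℂ) *
          FvT j S h v s (UnitaryGroup.evalPlace (Fp L) L (IsCMField.complexConj L) (2 + 2) (hermD L e dV hdV dW hdW) v.1
                (UnitaryGroup.finPart (Fp L) L (IsCMField.complexConj L) (2 + 2) (hermD L e dV hdV dW hdW) (SiegelDoubled.weylDelta L e dV hdV dW hdW)) *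
              ((y : ↥(unipDeltaLoc L e dV hdV dW hdW v.1)) : UnitaryGroup.localPi L (IsCMField.complexConj L) (2 + 2) (hermD L e dV hdV dW hdW) v.1) *
              UnitaryGroup.evalPlace (Fp L) L (IsCMField.complexConj L) (2 + 2) (hermD L e dV hdV dW hdW) v.1
                (UnitaryGroup.finPart (Fp L) L (IsCMField.complexConj L) (2 + 2) (hermD L e dV hdV dW hdW) h)) ∂(νv v.1) := by
  intro j S h v s hs hdet
  rw [hreadF', if_neg hdet]
  exact kindWFfin_eq_integral L e dV hdV dW hdW T₀ νv (fun v => HeckeCharacter.valued_uniformizer (K := Fp L) v) FvT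
    (hint_of_isLocalSiegelSection L e dV hdV dW hdW hdV0 hdW0 T₀ νv hχu FvT
      (hsec_of_reading L e dV hdV dW hdW 𝒦 s₀ hχS₀ b hb FvT hread) (hsm_of_reading L e dV hdV dW hdW 𝒦 s₀ hχS₀ b hb FvT hread)) j S h v s hs hdet

omit [∀ v : HeightOneSpectrum (𝓞 (Fp L)), BorelSpace ↥(unipDeltaLoc L e dV hdV dW hdW v)] [∀ v, (νv v).IsHaarMeasure] in
include hreadF' in
set_option maxHeartbeats 800000 in -- MEASURED as §2 (same Φ5 blocks; 400 000 ✗ ∕ 800 000 ✓)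
/-- **`hFfin` OF ★ ED. 4 FOR `Ffin := if det ↑S = 0 then 0 else kindWFfin …`, FROM THE PER-PLACE Φ5 LETTERS AT NON-SINGULAR `S` ONLY** (ED. 2; the guard `det ↑S ≠ 0` on `hsd` is
K2E3-p37 (g3)'s payable letter `hsd_of_level_of_det_ne_zero`; singular `S` ⇒ the constant `0`; off `kindWFinset` ⇒ ★ `kindWFfin_of_not_mem`).
[cite: KudlaRallis1994, §2] [cite: Shimura1997, §18.3–18.4] -/
theorem hFfin_of_reading'
    (hsd : ∀ (j : Fin m) (S : skewMatrices ((IsCMField.complexConj L : L ≃ₐ[Fp L] L) : L →+* L) ((gramR L e dV hdV dW hdW).map (algebraMap (Fp L) L)))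
      (h : HA L e dV hdV dW hdW) (v : (kindWFinset L e dV hdV dW hdW T₀ (S : Matrix (Fin 2) (Fin 2) L) h)), (S : Matrix (Fin 2) (Fin 2) L).det ≠ 0 → ∃ K : ℕ,
      (∀ (s : ℂ) (k : ℕ), K ≤ k →
      ∫ y in kindWLocalBall L e dV hdV dW hdW v.1 ((fun v => (HeckeCharacter.uniformizer (Fp L) v : v.adicCompletion (Fp L))) v.1) (-(k : ℤ)),
        conj (unipDeltaChar L e dV hdV dW hdW (S : Matrix (Fin 2) (Fin 2) L)
            (locToAdelic L e dV hdV dW hdW v.1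
              ((y : ↥(unipDeltaLoc L e dV hdV dW hdW v.1)) : UnitaryGroup.localPi L (IsCMField.complexConj L) (2 + 2) (hermD L e dV hdV dW hdW) v.1)) : ℂ) *
          FvT j S h v s (UnitaryGroup.evalPlace (Fp L) L (IsCMField.complexConj L) (2 + 2) (hermD L e dV hdV dW hdW) v.1
                (UnitaryGroup.finPart (Fp L) L (IsCMField.complexConj L) (2 + 2) (hermD L e dV hdV dW hdW) (SiegelDoubled.weylDelta L e dV hdV dW hdW)) *
              ((y : ↥(unipDeltaLoc L e dV hdV dW hdW v.1)) : UnitaryGroup.localPi L (IsCMField.complexConj L) (2 + 2) (hermD L e dV hdV dW hdW) v.1) *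
              UnitaryGroup.evalPlace (Fp L) L (IsCMField.complexConj L) (2 + 2) (hermD L e dV hdV dW hdW) v.1
                (UnitaryGroup.finPart (Fp L) L (IsCMField.complexConj L) (2 + 2) (hermD L e dV hdV dW hdW) h)) ∂(νv v.1) =
      ∫ y in kindWLocalBall L e dV hdV dW hdW v.1 ((fun v => (HeckeCharacter.uniformizer (Fp L) v : v.adicCompletion (Fp L))) v.1) (-(K : ℤ)),
        conj (unipDeltaChar L e dV hdV dW hdW (S : Matrix (Fin 2) (Fin 2) L)
            (locToAdelic L e dV hdV dW hdW v.1
              ((y : ↥(unipDeltaLoc L e dV hdV dW hdW v.1)) : UnitaryGroup.localPi L (IsCMField.complexConj L) (2 + 2) (hermD L e dV hdV dW hdW) v.1)) : ℂ) *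
          FvT j S h v s (UnitaryGroup.evalPlace (Fp L) L (IsCMField.complexConj L) (2 + 2) (hermD L e dV hdV dW hdW) v.1
                (UnitaryGroup.finPart (Fp L) L (IsCMField.complexConj L) (2 + 2) (hermD L e dV hdV dW hdW) (SiegelDoubled.weylDelta L e dV hdV dW hdW)) *
              ((y : ↥(unipDeltaLoc L e dV hdV dW hdW v.1)) : UnitaryGroup.localPi L (IsCMField.complexConj L) (2 + 2) (hermD L e dV hdV dW hdW) v.1) *
              UnitaryGroup.evalPlace (Fp L) L (IsCMField.complexConj L) (2 + 2) (hermD L e dV hdV dW hdW) v.1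
                (UnitaryGroup.finPart (Fp L) L (IsCMField.complexConj L) (2 + 2) (hermD L e dV hdV dW hdW) h)) ∂(νv v.1)) ∧
      (Differentiable ℂ fun s : ℂ =>
      ∫ y in kindWLocalBall L e dV hdV dW hdW v.1 ((fun v => (HeckeCharacter.uniformizer (Fp L) v : v.adicCompletion (Fp L))) v.1) (-(K : ℤ)),
        conj (unipDeltaChar L e dV hdV dW hdW (S : Matrix (Fin 2) (Fin 2) L)
            (locToAdelic L e dV hdV dW hdW v.1
              ((y : ↥(unipDeltaLoc L e dV hdV dW hdW v.1)) : UnitaryGroup.localPi L (IsCMField.complexConj L) (2 + 2) (hermD L e dV hdV dW hdW) v.1)) : ℂ) *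
          FvT j S h v s (UnitaryGroup.evalPlace (Fp L) L (IsCMField.complexConj L) (2 + 2) (hermD L e dV hdV dW hdW) v.1
                (UnitaryGroup.finPart (Fp L) L (IsCMField.complexConj L) (2 + 2) (hermD L e dV hdV dW hdW) (SiegelDoubled.weylDelta L e dV hdV dW hdW)) *
              ((y : ↥(unipDeltaLoc L e dV hdV dW hdW v.1)) : UnitaryGroup.localPi L (IsCMField.complexConj L) (2 + 2) (hermD L e dV hdV dW hdW) v.1) *
              UnitaryGroup.evalPlace (Fp L) L (IsCMField.complexConj L) (2 + 2) (hermD L e dV hdV dW hdW) v.1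
                (UnitaryGroup.finPart (Fp L) L (IsCMField.complexConj L) (2 + 2) (hermD L e dV hdV dW hdW) h)) ∂(νv v.1))) :
    ∀ j S (h : HA L e dV hdV dW hdW) v, DifferentiableOn ℂ (Ffin' j S h v) {s : ℂ | 0 < s.re} := by
  intro j S h v
  by_cases hdet : (S : Matrix (Fin 2) (Fin 2) L).det = 0
  · have h0 : Ffin' j S h v = fun _ => 0 := funext fun s => by rw [hreadF', if_pos hdet]
    rw [h0]
    exact differentiableOn_const 0
  · have hfun : Ffin' j S h v = kindWFfin L e dV hdV dW hdW T₀ νv (fun v => (HeckeCharacter.uniformizer (Fp L) v : v.adicCompletion (Fp L))) FvT j S h v :=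
      funext fun s => by rw [hreadF', if_neg hdet]
    rw [hfun]
    by_cases hv : v ∈ kindWFinset L e dV hdV dW hdW T₀ (S : Matrix (Fin 2) (Fin 2) L) h
    · obtain ⟨K, hstable, hdiff⟩ := hsd j S h ⟨v, hv⟩ hdet
      exact differentiableOn_kindWFfin_of_stable L e dV hdV dW hdW T₀ νv _ FvT j S h ⟨v, hv⟩ K hstable hdiff
    · have h0 : kindWFfin L e dV hdV dW hdW T₀ νv (fun v => (HeckeCharacter.uniformizer (Fp L) v : v.adicCompletion (Fp L))) FvT j S h v = fun _ => 0 :=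
        funext fun s => kindWFfin_of_not_mem L e dV hdV dW hdW T₀ νv _ FvT j S h hv s
      rw [h0]
      exact differentiableOn_const 0

end AtZero

end Summit.HodgeConjecture.HodgeConjecture.Cruxes.HLiu418.K2LiuKindWFiniteLetterOfReading

end
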